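import Mathlib.Probability.Moments.MGFAnalytic
import Mathlib.Analysis.InnerProductSpace.Calculus
import Literature.Analysis.FluidPDE.SawtoothCascade
import HarnessLib

/-!
# The sawtooth cascade field is jointly smooth on `[0, 1) × 𝕋²` (proved): `CascadeFieldSmooth`

Proofs-layer companion of `Literature.Analysis.FluidPDE.SawtoothCascade` (theorems only, no definitions,
no named facts). It DISCHARGES the anti-vacuity support predicate `SawtoothCascade.CascadeFieldSmooth P`
(joint `C^∞` smoothness of the cascade field `ū` on `Ico 0 1 × 𝕋²`) for every parameter set with
`0 < δ₀` and `0 < d` (`SawtoothCascade.cascadeFieldSmooth`) — the conjunct that the cell `ad-ideate`'s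
K1loc / K3loc cruxes carry next to `K1Localised`.

Route. (1) `contDiff_integral_exp_mul`: for a continuous density `0 ≤ ρ ≤ K e^{−b z²}` the exponential
moment integral `t ↦ ∫ e^{t z} ρ(z) dz` is the moment generating function of the finite measure `ρ dz`,
all of whose exponential moments exist, hence real-analytic on `ℝ` (Mathlib
`ProbabilityTheory.analyticOnNhd_mgf`) and so `C^∞` (differentiation under the integral sign, Folland
Thm. 2.27). (2) `contDiff_roundedSaw`: completing the square,
`S_δ(θ) = ∫ tri(z) g_δ(θ − z) dz = (δ√(2π))⁻¹ e^{−θ²/2δ²} [M₁(θ/δ²) − (π/2) M₀(θ/δ²)]` with `M₁`, `M₀` the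
moment integrals of `(tri + π/2) e^{−z²/2δ²} ≥ 0` and `e^{−z²/2δ²}`; hence the rounded sawtooth and every
profile `U j` are `C^∞` (`CascadeParams.contDiff_U`). (3) The pulse envelopes `bump`, `rateH j`, `rateV j`
are `C^∞` (`expNegInvGlue`). (4) On `t < tStart J` only the phases `j < J` are active, so the space–time
lift of the field is locally a finite sum of products of smooth functions of `t` and of one coordinate;
`ContDiffOn` is local (`contDiffOn_of_locally_contDiffOn`).

## Mathlib / tree search

Mathlib: `ProbabilityTheory.analyticOnNhd_mgf`, `AnalyticOnNhd.contDiff`, `integral_withDensity_eq_integral_smul`,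
`integrable_withDensity_iff_integrable_smul`, `integral_sub_left_eq_self`, `integrable_exp_neg_mul_sq`,
`contDiff_euclidean`, `contDiffOn_of_locally_contDiffOn`, `tsum_eq_sum`; no ready-made "Gaussian mollification
is smooth" (`HasCompactSupport.contDiff_convolution_right` needs compact support). Tree: Part 9/10 of
`SawtoothCascade` (`U_periodic`, `rateH_of_le_tStart`, `rateV_of_le`, `tendsto_tStart`, `δ_pos`),
`Torus.lift_coordFun_apply` (`TorusCoordinateFunctions`).

## References

* G. B. Folland, *Real Analysis*, 2nd ed., Wiley 1999, Thm. 2.27 (differentiation under the integral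
  sign), §8.2 Prop. 8.10 (smoothness of convolutions). [`Folland1999`]
* T. Elgindi, K. Liss, J. Mattingly, arXiv:2304.05374, §1 and Rmk. 1.4 (smooth pulsed shears). [`ElgindiLissMattingly2025`]
* E. Bruè, C. De Lellis, CMP 2023, §2 Question 2.1 (smoothness on the half-open time interval). [`BrueDeLellisCMP2023`]
-/

noncomputable section

open MeasureTheory ProbabilityTheory Set Filter Topology
open scoped NNReal ENNReal ContDiff

namespace Literature.Analysis.FluidPDE.SawtoothCascade

open Literature.Analysis Literature.Analysis.FunctionSpaces

/-! ## §1 Exponential moment integrals of Gaussian-tailed densities are smooth -/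

/-- All exponential moments of a Gaussian-tailed continuous function exist:
`z ↦ e^{t z} ρ(z)` is integrable when `|ρ(z)| ≤ K e^{−b z²}`, `b > 0` (complete the square).
[cite: Folland1999, Prop. 2.53 (Gaussian integrals)] -/
theorem integrable_exp_mul_mul_of_gaussian_bound {ρ : ℝ → ℝ} (hρc : Continuous ρ) {K b : ℝ}
    (hb : 0 < b) (hρ : ∀ z, |ρ z| ≤ K * Real.exp (-b * z ^ 2)) (t : ℝ) :
    Integrable (fun z => Real.exp (t * z) * ρ z) := by
  have hdom : Integrable (fun z : ℝ => K * Real.exp (t ^ 2 / (4 * b)) *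
      Real.exp (-b * (z - t / (2 * b)) ^ 2)) :=
    ((integrable_exp_neg_mul_sq hb).comp_sub_right (t / (2 * b))).const_mul _
  refine hdom.mono' ((by fun_prop : Continuous fun z => Real.exp (t * z) * ρ z).aestronglyMeasurable)
    (ae_of_all _ fun z => ?_)
  rw [Real.norm_eq_abs, abs_mul, abs_of_pos (Real.exp_pos _)]
  calc Real.exp (t * z) * |ρ z| ≤ Real.exp (t * z) * (K * Real.exp (-b * z ^ 2)) := by
        gcongr
        exact hρ z
    _ = K * (Real.exp (t * z) * Real.exp (-b * z ^ 2)) := by ring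
    _ = K * (Real.exp (t ^ 2 / (4 * b)) * Real.exp (-b * (z - t / (2 * b)) ^ 2)) := by
        rw [← Real.exp_add, ← Real.exp_add]
        congr 2
        field_simp
        ring
    _ = K * Real.exp (t ^ 2 / (4 * b)) * Real.exp (-b * (z - t / (2 * b)) ^ 2) := by ring

/-- **Exponential moment integrals of a nonnegative Gaussian-tailed continuous density are `C^∞`**:
`t ↦ ∫ e^{t z} ρ(z) dz` is the moment generating function of the finite measure `ρ(z) dz`, all of whose
exponential moments exist, hence real-analytic on `ℝ` (differentiation under the integral sign).
[cite: Folland1999, Thm. 2.27 (differentiation under the integral sign)] -/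
theorem contDiff_integral_exp_mul {ρ : ℝ → ℝ} (hρc : Continuous ρ) (hρ0 : ∀ z, 0 ≤ ρ z) {K b : ℝ}
    (hb : 0 < b) (hρ : ∀ z, ρ z ≤ K * Real.exp (-b * z ^ 2)) {n : WithTop ℕ∞} :
    ContDiff ℝ n (fun t => ∫ z, Real.exp (t * z) * ρ z) := by
  set ρN : ℝ → ℝ≥0 := fun z => (ρ z).toNNReal with hρN
  have hρNm : Measurable ρN := hρc.measurable.real_toNNReal
  have hρN_eq : ∀ z, (ρN z : ℝ) = ρ z := fun z => Real.coe_toNNReal _ (hρ0 z)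
  set μ : Measure ℝ := volume.withDensity (fun z => (ρN z : ℝ≥0∞)) with hμ
  have hmgf : (fun t => ∫ z, Real.exp (t * z) * ρ z) = mgf (fun z : ℝ => z) μ := by
    funext t
    rw [mgf, hμ, integral_withDensity_eq_integral_smul hρNm]
    refine integral_congr_ae (ae_of_all _ fun z => ?_)
    simp only [NNReal.smul_def, hρN_eq, smul_eq_mul]
    ring
  have hset : integrableExpSet (fun z : ℝ => z) μ = univ := by
    refine eq_univ_of_forall fun t => ?_
    change Integrable (fun z : ℝ => Real.exp (t * z)) μ
    rw [hμ, integrable_withDensity_iff_integrable_smul hρNm]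
    have h := integrable_exp_mul_mul_of_gaussian_bound hρc hb
      (fun z => by rw [abs_of_nonneg (hρ0 z)]; exact hρ z) t
    refine h.congr (ae_of_all _ fun z => ?_)
    simp only [NNReal.smul_def, hρN_eq, smul_eq_mul]
    ring
  rw [hmgf]
  have han : AnalyticOnNhd ℝ (mgf (fun z : ℝ => z) μ) univ := by
    rw [← interior_univ, ← hset]
    exact analyticOnNhd_mgf
  exact han.contDiff

/-! ## §2 The rounded sawtooth and the profiles `U j` are smooth -/

/-- **The rounded sawtooth `S_δ = tri ⋆ gaussKernel δ` is `C^∞`** (`δ > 0`): after completing the square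
it is `(δ√(2π))⁻¹ e^{−θ²/2δ²}` times a difference of exponential moment integrals of Gaussian-tailed
nonnegative densities, evaluated at `θ/δ²`. [cite: Folland1999, §8.2 Prop. 8.10 (derivatives of a convolution fall on the smooth factor) with Thm. 2.27] -/
theorem contDiff_roundedSaw {δ : ℝ} (hδ : 0 < δ) {n : WithTop ℕ∞} : ContDiff ℝ n (roundedSaw δ) := by
  have hb : 0 < 1 / (2 * δ ^ 2) := by positivity
  -- the two densities
  have hρ₁c : Continuous fun z : ℝ => (tri z + Real.pi / 2) * Real.exp (-(1 / (2 * δ ^ 2)) * z ^ 2) := by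
    have := continuous_tri
    fun_prop
  have hρ₁0 : ∀ z : ℝ, 0 ≤ (tri z + Real.pi / 2) * Real.exp (-(1 / (2 * δ ^ 2)) * z ^ 2) := fun z =>
    mul_nonneg (by linarith [(abs_le.mp (abs_tri_le z)).1]) (Real.exp_pos _).le
  have hρ₁b : ∀ z : ℝ, (tri z + Real.pi / 2) * Real.exp (-(1 / (2 * δ ^ 2)) * z ^ 2) ≤
      Real.pi * Real.exp (-(1 / (2 * δ ^ 2)) * z ^ 2) := fun z =>
    mul_le_mul_of_nonneg_right (by linarith [(abs_le.mp (abs_tri_le z)).2]) (Real.exp_pos _).le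
  have hρ₀c : Continuous fun z : ℝ => Real.exp (-(1 / (2 * δ ^ 2)) * z ^ 2) := by fun_prop
  have hρ₀0 : ∀ z : ℝ, 0 ≤ Real.exp (-(1 / (2 * δ ^ 2)) * z ^ 2) := fun z => (Real.exp_pos _).le
  have hρ₀b : ∀ z : ℝ, Real.exp (-(1 / (2 * δ ^ 2)) * z ^ 2) ≤ 1 * Real.exp (-(1 / (2 * δ ^ 2)) * z ^ 2) :=
    fun z => by rw [one_mul]
  have h₁ : ContDiff ℝ n fun t => ∫ z, Real.exp (t * z) *
      ((tri z + Real.pi / 2) * Real.exp (-(1 / (2 * δ ^ 2)) * z ^ 2)) :=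
    contDiff_integral_exp_mul hρ₁c hρ₁0 hb hρ₁b
  have h₀ : ContDiff ℝ n fun t => ∫ z, Real.exp (t * z) * Real.exp (-(1 / (2 * δ ^ 2)) * z ^ 2) :=
    contDiff_integral_exp_mul hρ₀c hρ₀0 hb hρ₀b
  -- integrability of the two moment integrands at every parameter
  have hi₁ : ∀ t, Integrable fun z => Real.exp (t * z) *
      ((tri z + Real.pi / 2) * Real.exp (-(1 / (2 * δ ^ 2)) * z ^ 2)) := fun t =>
    integrable_exp_mul_mul_of_gaussian_bound hρ₁c hb (fun z => by rw [abs_of_nonneg (hρ₁0 z)]; exact hρ₁b z) t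
  have hi₀ : ∀ t, Integrable fun z => Real.exp (t * z) * Real.exp (-(1 / (2 * δ ^ 2)) * z ^ 2) := fun t =>
    integrable_exp_mul_mul_of_gaussian_bound hρ₀c hb (fun z => by rw [abs_of_nonneg (hρ₀0 z)]; exact hρ₀b z) t
  -- pointwise completing the square
  have hpt : ∀ θ z : ℝ, tri z * gaussKernel δ (θ - z) =
      (δ * Real.sqrt (2 * Real.pi))⁻¹ * Real.exp (-(1 / (2 * δ ^ 2)) * θ ^ 2) *
        (Real.exp (θ / δ ^ 2 * z) * ((tri z + Real.pi / 2) * Real.exp (-(1 / (2 * δ ^ 2)) * z ^ 2)) -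
          Real.pi / 2 * (Real.exp (θ / δ ^ 2 * z) * Real.exp (-(1 / (2 * δ ^ 2)) * z ^ 2))) := by
    intro θ z
    have he : Real.exp (-((θ - z) ^ 2 / (2 * δ ^ 2))) = Real.exp (-(1 / (2 * δ ^ 2)) * θ ^ 2) *
        Real.exp (θ / δ ^ 2 * z) * Real.exp (-(1 / (2 * δ ^ 2)) * z ^ 2) := by
      rw [← Real.exp_add, ← Real.exp_add]
      congr 1
      field_simp
      ring
    simp only [gaussKernel]
    rw [he]
    ring
  -- the formula
  have hformula : roundedSaw δ = fun θ => (δ * Real.sqrt (2 * Real.pi))⁻¹ *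
      Real.exp (-(1 / (2 * δ ^ 2)) * θ ^ 2) *
        ((∫ z, Real.exp (θ / δ ^ 2 * z) * ((tri z + Real.pi / 2) * Real.exp (-(1 / (2 * δ ^ 2)) * z ^ 2))) -
          Real.pi / 2 * ∫ z, Real.exp (θ / δ ^ 2 * z) * Real.exp (-(1 / (2 * δ ^ 2)) * z ^ 2)) := by
    funext θ
    have hsub := integral_sub_left_eq_self (fun z => tri z * gaussKernel δ (θ - z)) volume θ
    simp only [sub_sub_cancel] at hsub
    rw [roundedSaw, hsub, integral_congr_ae (ae_of_all _ (hpt θ)), integral_const_mul,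
      integral_sub (hi₁ _) ((hi₀ _).const_mul _), integral_const_mul]
  rw [hformula]
  have hlin : ContDiff ℝ n fun θ : ℝ => θ / δ ^ 2 := contDiff_id.div_const _
  have hgauss : ContDiff ℝ n fun θ : ℝ => Real.exp (-(1 / (2 * δ ^ 2)) * θ ^ 2) := by
    have : ContDiff ℝ n fun θ : ℝ => -(1 / (2 * δ ^ 2)) * θ ^ 2 := by fun_prop
    exact Real.contDiff_exp.comp this
  exact (contDiff_const.mul hgauss).mul ((h₁.comp hlin).sub (contDiff_const.mul (h₀.comp hlin)))

namespace CascadeParams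

variable (P : CascadeParams)

/-- **Each profile `U j` is `C^∞`** (`δ j > 0`). [cite: ElgindiLissMattingly2025, §1 (the shear profiles; here mollified)] -/
theorem contDiff_U {j : ℕ} (hδ : 0 < P.δ j) {n : WithTop ℕ∞} : ContDiff ℝ n (P.U j) := by
  have h : ContDiff ℝ n fun y : ℝ => 2 * Real.pi * (P.N j : ℝ) * y := by fun_prop
  exact ((contDiff_roundedSaw hδ).comp h).div_const _

end CascadeParams

/-! ## §3 The pulse envelopes are smooth -/

/-- `bump` is `C^∞`. [cite: ElgindiLissMattingly2025, Rmk. 1.4 (smooth-in-time pulses φ)] -/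
theorem contDiff_bump : ContDiff ℝ ∞ CascadeParams.bump := by
  unfold CascadeParams.bump
  exact (expNegInvGlue.contDiff.mul (expNegInvGlue.contDiff.comp (contDiff_const.sub contDiff_id))).div_const _

namespace CascadeParams

variable (P : CascadeParams)

/-- `rateH j` is `C^∞` in time. [cite: ElgindiLissMattingly2025, Rmk. 1.4 (smooth-in-time pulses φ)] -/
theorem contDiff_rateH (j : ℕ) : ContDiff ℝ ∞ (P.rateH j) := by
  unfold rateH
  exact contDiff_const.mul (contDiff_bump.comp ((contDiff_id.sub contDiff_const).div_const _))

/-- `rateV j` is `C^∞` in time. [cite: ElgindiLissMattingly2025, Rmk. 1.4 (smooth-in-time pulses φ)] -/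
theorem contDiff_rateV (j : ℕ) : ContDiff ℝ ∞ (P.rateV j) := by
  unfold rateV
  exact contDiff_const.mul
    (contDiff_bump.comp (((contDiff_id.sub contDiff_const).sub contDiff_const).div_const _))

/-! ## §4 Joint smoothness of the cascade field on `[0, 1) × 𝕋²` -/

/-- The space–time lift of the cascade field in coordinates: the profiles read on the lifted
coordinates (`U j` is `1`-periodic). [cite: ElgindiLissMattingly2025, §1 (u_α on 𝕋²)] -/
theorem stLift_field_apply (z : ℝ × EuclideanSpace ℝ (Fin 2)) :
    Torus.stLift P.field z =
      WithLp.toLp 2 ![∑' j, P.rateH j z.1 * P.U j (z.2 1), ∑' j, P.rateV j z.1 * P.U j (z.2 0)] := by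
  have hU : ∀ (j : ℕ) (i : Fin 2), P.U j (Torus.repr (Torus.proj z.2) i) = P.U j (z.2 i) := fun j i => by
    simpa using Torus.lift_coordFun_apply (P.U_periodic j) i z.2
  show P.field z.1 (Torus.proj z.2) = _
  simp only [field, hU]

/-- Before `tStart J` only the phases `j < J` are active: the H sum is finite there.
[cite: ElgindiLissMattingly2025, Rmk. 1.4 (compactly supported pulses)] -/
theorem tsum_rateH_eq_sum_of_lt {J : ℕ} {t : ℝ} (ht : t < tStart J) (y : ℝ) :
    ∑' j, P.rateH j t * P.U j y = ∑ j ∈ Finset.range J, P.rateH j t * P.U j y := by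
  refine tsum_eq_sum fun j hj => ?_
  have hJj : J ≤ j := by simpa using hj
  rw [P.rateH_of_le_tStart (ht.le.trans (tStart_strictMono.monotone hJj)), zero_mul]

/-- Before `tStart J` only the phases `j < J` are active: the V sum is finite there.
[cite: ElgindiLissMattingly2025, Rmk. 1.4 (compactly supported pulses)] -/
theorem tsum_rateV_eq_sum_of_lt {J : ℕ} {t : ℝ} (ht : t < tStart J) (y : ℝ) :
    ∑' j, P.rateV j t * P.U j y = ∑ j ∈ Finset.range J, P.rateV j t * P.U j y := by
  refine tsum_eq_sum fun j hj => ?_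
  have hJj : J ≤ j := by simpa using hj
  rw [P.rateV_of_le ((ht.le.trans (tStart_strictMono.monotone hJj)).trans (le_add_of_nonneg_right
    (tHalf_pos j).le)), zero_mul]

end CascadeParams

/-- **The cascade field is jointly `C^∞` on `[0, 1) × 𝕋²`** for every parameter set with `0 < δ₀` and
`0 < d`: the support predicate `CascadeFieldSmooth P` HOLDS (so `K1Localised` and the K1loc / K3loc cruxes
are not vacuous on that account). [cite: BrueDeLellisCMP2023, §2 Question 2.1 (smoothness on the half-open interval); ElgindiLissMattingly2025, Rmk. 1.4 (smooth pulsed shears)] -/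
theorem cascadeFieldSmooth (P : CascadeParams) (hδ₀ : 0 < P.δ₀) (hd : 0 < P.d) : CascadeFieldSmooth P := by
  unfold CascadeFieldSmooth Torus.IsSmoothSpaceTimeOn
  have hcoord : ∀ i : Fin 2, ContDiff ℝ ∞ fun y : EuclideanSpace ℝ (Fin 2) => y i := fun i =>
    contDiff_euclidean.1 contDiff_id i
  refine contDiffOn_of_locally_contDiffOn fun z hz => ?_
  have hz1 : z.1 < 1 := (mem_prod.1 hz).1.2
  obtain ⟨J, hJ⟩ : ∃ J, z.1 < CascadeParams.tStart J :=
    ((tendsto_order.1 CascadeParams.tendsto_tStart).1 z.1 hz1).exists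
  refine ⟨Iio (CascadeParams.tStart J) ×ˢ univ, isOpen_Iio.prod isOpen_univ, ⟨hJ, mem_univ _⟩, ?_⟩
  -- the finite-sum field below `tStart J`
  set G : ℝ × EuclideanSpace ℝ (Fin 2) → EuclideanSpace ℝ (Fin 2) := fun w =>
    WithLp.toLp 2 ![∑ j ∈ Finset.range J, P.rateH j w.1 * P.U j (w.2 1),
      ∑ j ∈ Finset.range J, P.rateV j w.1 * P.U j (w.2 0)] with hG
  have hGs : ContDiff ℝ ∞ G := by
    rw [contDiff_euclidean]
    intro i
    fin_cases i
    · simp only [hG, PiLp.toLp_apply, Fin.zero_eta, Matrix.cons_val_zero]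
      exact ContDiff.sum fun j _ => ((P.contDiff_rateH j).comp contDiff_fst).mul
        ((P.contDiff_U (P.δ_pos hδ₀ hd j)).comp ((hcoord 1).comp contDiff_snd))
    · simp only [hG, PiLp.toLp_apply, Fin.mk_one, Matrix.cons_val_one, Matrix.cons_val_zero]
      exact ContDiff.sum fun j _ => ((P.contDiff_rateV j).comp contDiff_fst).mul
        ((P.contDiff_U (P.δ_pos hδ₀ hd j)).comp ((hcoord 0).comp contDiff_snd))
  refine hGs.contDiffOn.congr fun w hw => ?_
  have hwJ : w.1 < CascadeParams.tStart J := (mem_prod.1 hw.2).1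
  rw [P.stLift_field_apply w, P.tsum_rateH_eq_sum_of_lt hwJ, P.tsum_rateV_eq_sum_of_lt hwJ]

end Literature.Analysis.FluidPDE.SawtoothCascade

end
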